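/-
Copyright (c) 2026. All rights reserved.
Released under Apache 2.0 license as described in the file LICENSE.
-/
import Summits.Langlands.Langlands.Theorems.SoloInformedBmaxInvariantsUnramified
import Summits.Langlands.Langlands.Theorems.SoloInformedRepairD2CrisResidueDegree
import HarnessLib

/-!
# `W(k̄)^{Γ_F} = W(k_F)`: the invariant unramified Witt vectors (solo programme, rung Λ7)

Programme `solo-Langlands-informed`, repair of the crystalline clause D2-cris of `Summit.Langlands`
(`SpecC` = the comparison `B_max(F)^{Γ_F} = K₀ = W(k_F)[1/p]`).

State before this file.  The invariants theorems of the programme — Λ2 `SpecC.forall_galBmaxPlus_iff`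
(`(A_max)^{Γ_F}`), Λ3 `SpecC.forall_galBmax_iff_of_isPIntegral` (`A_max[1/p]`), Λ5/Λ6
`SpecC.forall_galBmax_iff_of_tCriterion` / `_of_unramified` (all of `B_max(F) = A_max[1/t]`) — describe a
`Γ_F`-invariant period as `p⁻ⁿ ι(z)` with `z` a **`Γ_F`-invariant Witt vector over `k̄`**, the residue field of
`𝒪̂_{F^nr}` (`ResidueField (maxUnramifiedCompletion F)`), i.e. `z ∈ W(k̄)^{Γ_F}`.  The identification
`W(k̄)^{Γ_F} = W(k_F)` (so that the right-hand side is literally `K₀ = W(k_F)[1/p] = Frac W(k_F)`) was used in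
the docstrings but not proved.  This file proves it:

* §1 `resBarField : k_F ↪ k̄`, the embedding induced by `resBar : 𝒪_F → k̄` (tree, kernel `𝔪_F`);
* §2 `mem_range_resBar_of_pow_residueFieldCard_eq` : **`{y ∈ k̄ : y^q = y} = k_F`** (`q = q_F = #k_F`): the
  `q` residues of `k_F` are roots of `X^q − X`, which has at most `q` roots in the field `k̄`;
  `forall_residueGal_eq_iff_mem_range` ★ : **`k̄^{Γ_F} = k_F`**, because an arithmetic Frobenius `σ₀ ∈ Γ_F`
  (tree `exists_isAbsArithFrob_holds`) acts on `k̄` as `y ↦ y^q` (tree `IsAbsArithFrob.residueGal_eq_pow`);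
* §3 `forall_map_residueGal_eq_iff` ★★ : **`W(k̄)^{Γ_F} = W(k_F)`** — `Γ_F` acts on `W(k̄)` coefficientwise
  (`WittVector.map`), so a Witt vector is invariant iff every coefficient lies in `k_F`;
* §4 the programme's invariants theorems with the Witt vector over `k_F`:
  `SpecC.forall_galBmaxPlus_iff_exists_witt` (**`(A_max)^{Γ_F} = ι W(k_F)`**, any `F`),
  `SpecC.forall_galBmax_iff_exists_witt_of_isPIntegral` (`A_max[1/p]`, any `F`),
  `SpecC.forall_galBmax_iff_exists_witt_of_unramified` (**`B_max(F)^{Γ_F} = W(k_F)[1/p] = K₀`** for absolutely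
  unramified `F`, unconditional).

References: Serre, *Local Fields* (1979), Ch. II §§4–5 (`W(k)`, unramified extensions), Ch. IV §4;
Fontaine, Astérisque 223 (1994), Exp. II §1.5, Exp. III §4.1; Colmez, Ann. of Math. 148 (1998), §III.2.
-/

noncomputable section

open WittVector Field IsLocalRing ValuativeRel Polynomial
open Literature.NumberTheory.GaloisRepresentations Literature.NumberTheory.PAdicHodge
open Literature.NumberTheory.GaloisRepresentations.IsNonarchimedeanLocalField

namespace Summit.Langlands.Langlands.Theorems

namespace D2Cris

variable {F : Type} [Field F] [ValuativeRel F] [TopologicalSpace F] [IsNonarchimedeanLocalField F]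

/-! ### §1 `k_F ↪ k̄` -/

section Residue

variable (F) in
/-- **`k_F ↪ k̄`**: the embedding of the residue field `k_F = 𝒪_F/𝔪_F` of `F` into the residue field `k̄` of
`𝒪̂_{F^nr}`, induced by `resBar : 𝒪_F → k̄` (whose kernel is `𝔪_F`, `resBar_eq_zero_iff`).
[cite: SerreLocalFields1979, Ch. II §4] -/
def resBarField : 𝓀[F] →+* ResidueField (maxUnramifiedCompletion F) :=
  Ideal.Quotient.lift _ (resBar F) fun a ha => (resBar_eq_zero_iff a).2 ha

/-- `resBarField (res a) = ā`. [folklore] -/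
theorem resBarField_residue (a : 𝒪[F]) :
    resBarField F (IsLocalRing.residue 𝒪[F] a) = resBar F a := rfl

/-- `resBarField ∘ res = resBar`. [folklore] -/
theorem resBarField_comp_residue : (resBarField F).comp (IsLocalRing.residue 𝒪[F]) = resBar F :=
  RingHom.ext resBarField_residue

/-- `k_F → k̄` is injective (a ring map out of a field). [folklore] -/
theorem resBarField_injective : Function.Injective (resBarField F) :=
  (resBarField F).injective

/-- The image of `k_F` in `k̄` is the set of residues of `𝒪_F`. [folklore] -/
theorem range_resBarField : Set.range (resBarField F) = Set.range (resBar F) := by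
  ext y
  constructor
  · rintro ⟨x, rfl⟩
    obtain ⟨a, rfl⟩ := IsLocalRing.residue_surjective x
    exact ⟨a, rfl⟩
  · rintro ⟨a, rfl⟩
    exact ⟨IsLocalRing.residue 𝒪[F] a, rfl⟩

/-- **`Γ_F` fixes `k_F ⊆ k̄`.** [cite: SerreLocalFields1979, Ch. II §4] -/
theorem residueGal_resBarField (σ : absoluteGaloisGroup F) (x : 𝓀[F]) :
    residueGal σ (resBarField F x) = resBarField F x := by
  obtain ⟨a, rfl⟩ := IsLocalRing.residue_surjective x
  rw [resBarField_residue, residueGal_resBar]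

/-- `x̄ ^ q_F = x̄` for `x ∈ k_F` (`#k_F = q_F`). [cite: SerreLocalFields1979, Ch. II §4] -/
theorem resBarField_pow_residueFieldCard (x : 𝓀[F]) :
    resBarField F x ^ residueFieldCard F = resBarField F x := by
  obtain ⟨a, rfl⟩ := IsLocalRing.residue_surjective x
  rw [resBarField_residue, resBar_pow_residueFieldCard]

end Residue

/-! ### §2 `k̄^{Γ_F} = k_F` -/

section FixedField

/-- **`{y ∈ k̄ : y ^ q = y} ⊆ k_F`** (`q = q_F`): an element of `k̄` fixed by the `q`-power map is the residue of an
element of `𝒪_F`.  (The `q` elements of `k_F ⊆ k̄` are roots of `X^q − X`, which has at most `q` roots in the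
field `k̄`.) [cite: SerreLocalFields1979, Ch. IV §4 Prop. 16] -/
theorem mem_range_resBar_of_pow_residueFieldCard_eq {y : ResidueField (maxUnramifiedCompletion F)}
    (hy : y ^ residueFieldCard F = y) : y ∈ Set.range (resBar F) := by
  haveI : Fintype 𝓀[F] := Fintype.ofFinite _
  have h1q : 1 < residueFieldCard F := one_lt_residueFieldCard F
  rw [← range_resBarField]
  by_contra hyS
  have hyS' : ∀ x : 𝓀[F], resBarField F x ≠ y := fun x hx => hyS ⟨x, hx⟩
  -- `k_F ⊔ {y} → k̄`, injective, with values roots of `X ^ q - X`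
  let g : Option 𝓀[F] → ResidueField (maxUnramifiedCompletion F) := fun o => o.elim y fun x => resBarField F x
  have hg : Function.Injective g := by
    intro o₁ o₂ h
    cases o₁ with
    | none =>
      cases o₂ with
      | none => rfl
      | some x₂ => exact absurd h.symm (hyS' x₂)
    | some x₁ =>
      cases o₂ with
      | none => exact absurd h (hyS' x₁)
      | some x₂ => exact congrArg some (resBarField_injective h)
  have heval : ∀ o : Option 𝓀[F],
      (X ^ residueFieldCard F - X : (ResidueField (maxUnramifiedCompletion F))[X]).eval (g o) = 0 := by
    intro o
    cases o with
    | none => simp only [g, Option.elim, eval_sub, eval_pow, eval_X, hy, sub_self]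
    | some x => simp only [g, Option.elim, eval_sub, eval_pow, eval_X, resBarField_pow_residueFieldCard, sub_self]
  -- but `X ^ q - X ≠ 0` has at most `q = #k_F < #(k_F ⊔ {y})` roots
  have hcard : (X ^ residueFieldCard F - X : (ResidueField (maxUnramifiedCompletion F))[X]).natDegree <
      Fintype.card (Option 𝓀[F]) := by
    rw [FiniteField.X_pow_card_sub_X_natDegree_eq _ h1q, Fintype.card_option, residueFieldCard,
      Nat.card_eq_fintype_card]
    exact Nat.lt_succ_self _
  exact FiniteField.X_pow_card_sub_X_ne_zero _ h1q
    (Polynomial.eq_zero_of_natDegree_lt_card_of_eval_eq_zero _ hg heval hcard)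

/-- **`k_F = {y ∈ k̄ : y ^ q_F = y}`.** [cite: SerreLocalFields1979, Ch. IV §4 Prop. 16] -/
theorem mem_range_resBar_iff_pow_residueFieldCard_eq (y : ResidueField (maxUnramifiedCompletion F)) :
    y ∈ Set.range (resBar F) ↔ y ^ residueFieldCard F = y :=
  ⟨by rintro ⟨a, rfl⟩; exact resBar_pow_residueFieldCard a, mem_range_resBar_of_pow_residueFieldCard_eq⟩

/-- ★ **`k̄^{Γ_F} = k_F`**: an element of the residue field `k̄` of `𝒪̂_{F^nr}` is fixed by `Γ_F` iff it is the
residue of an element of `𝒪_F`.  (`Γ_F` contains an arithmetic Frobenius, which acts on `k̄` as `y ↦ y ^ q_F`.)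
[cite: SerreLocalFields1979, Ch. IV §4 Prop. 16] [cite: TateCorvallis1979, §1.4 (1.4.1)] -/
theorem forall_residueGal_eq_iff_mem_range (y : ResidueField (maxUnramifiedCompletion F)) :
    (∀ σ : absoluteGaloisGroup F, residueGal σ y = y) ↔ y ∈ Set.range (resBar F) := by
  constructor
  · intro h
    obtain ⟨σ₀, hσ₀⟩ := exists_isAbsArithFrob_holds F
    exact mem_range_resBar_of_pow_residueFieldCard_eq ((IsAbsArithFrob.residueGal_eq_pow hσ₀ y).symm.trans (h σ₀))
  · rintro ⟨a, rfl⟩ σ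
    exact residueGal_resBar σ a

/-- `k̄^{Γ_F} = k_F`, stated with the embedding `k_F ↪ k̄`. [cite: SerreLocalFields1979, Ch. IV §4 Prop. 16] -/
theorem forall_residueGal_eq_iff_mem_range_resBarField (y : ResidueField (maxUnramifiedCompletion F)) :
    (∀ σ : absoluteGaloisGroup F, residueGal σ y = y) ↔ y ∈ Set.range (resBarField F) := by
  rw [range_resBarField, forall_residueGal_eq_iff_mem_range]

end FixedField

/-! ### §3 `W(k̄)^{Γ_F} = W(k_F)` -/

section Witt

variable {p : ℕ} [Fact p.Prime]

/-- `W(k_F) ⊆ W(k̄)^{Γ_F}`: `W(σ̄) (W(ι) w) = W(ι) w`. [cite: SerreLocalFields1979, Ch. II §5] -/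
theorem map_residueGal_map_resBarField (σ : absoluteGaloisGroup F) (w : WittVector p 𝓀[F]) :
    WittVector.map (residueGal σ) (WittVector.map (resBarField F) w) = WittVector.map (resBarField F) w := by
  ext n
  simp only [map_coeff, residueGal_resBarField]

/-- `W(k_F) → W(k̄)` is injective. [folklore] -/
theorem map_resBarField_injective : Function.Injective (WittVector.map (p := p) (resBarField F)) :=
  WittVector.map_injective _ resBarField_injective

/-- ★★ **`W(k̄)^{Γ_F} = W(k_F)`**: a Witt vector over the residue field `k̄` of `𝒪̂_{F^nr}` is fixed by `Γ_F`
(acting through `W(σ̄)`) iff it is (the image of) a Witt vector over `k_F` — `Γ_F` acts coefficientwise and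
`k̄^{Γ_F} = k_F`.  With `K₀ := W(k_F)[1/p]` this is `W(k̄)^{Γ_F}[1/p] = K₀`, the unramified part of
`B_max(F)^{Γ_F} = K₀`. [cite: SerreLocalFields1979, Ch. II §5] [cite: FontaineAsterisque223III, Exp. II §1.5] -/
theorem forall_map_residueGal_eq_iff (z : WittVector p (ResidueField (maxUnramifiedCompletion F))) :
    (∀ σ : absoluteGaloisGroup F, WittVector.map (residueGal σ) z = z) ↔
      z ∈ Set.range (WittVector.map (p := p) (resBarField F)) := by
  constructor
  · intro h
    have hc : ∀ n, ∃ x : 𝓀[F], resBarField F x = z.coeff n := fun n => by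
      have h1 : ∀ σ : absoluteGaloisGroup F, residueGal σ (z.coeff n) = z.coeff n := fun σ => by
        have h2 := congrArg (fun w : WittVector p (ResidueField (maxUnramifiedCompletion F)) => w.coeff n) (h σ)
        simpa only [map_coeff] using h2
      exact (forall_residueGal_eq_iff_mem_range_resBarField _).1 h1
    choose c hc using hc
    refine ⟨WittVector.mk p c, ?_⟩
    ext n
    rw [map_coeff]
    exact hc n
  · rintro ⟨w, rfl⟩ σ
    exact map_residueGal_map_resBarField σ w

/-- The existential form used by the programme's invariants theorems: `∃ z ∈ W(k̄)^{Γ_F}, P z` iff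
`∃ w ∈ W(k_F), P (W(ι) w)`. [folklore] -/
theorem exists_invariant_witt_iff (P : WittVector p (ResidueField (maxUnramifiedCompletion F)) → Prop) :
    (∃ z : WittVector p (ResidueField (maxUnramifiedCompletion F)),
        (∀ σ : absoluteGaloisGroup F, WittVector.map (residueGal σ) z = z) ∧ P z) ↔
      ∃ w : WittVector p 𝓀[F], P (WittVector.map (resBarField F) w) := by
  constructor
  · rintro ⟨z, hz, hP⟩
    obtain ⟨w, rfl⟩ := (forall_map_residueGal_eq_iff z).1 hz
    exact ⟨w, hP⟩
  · rintro ⟨w, hP⟩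
    exact ⟨_, (forall_map_residueGal_eq_iff _).2 ⟨w, rfl⟩, hP⟩

end Witt

end D2Cris

/-! ### §4 The invariants of `A_max`, `A_max[1/p]`, `B_max(F)` as Witt vectors over `k_F` -/

namespace SpecC

variable {F : Type} [Field F] [ValuativeRel F] [TopologicalSpace F] [IsNonarchimedeanLocalField F] [CharZero F]
  {p : ℕ} [Fact p.Prime] [Fact (¬ IsUnit (p : integerC F))] [IsAdicComplete (Ideal.span {(p : integerC F)}) (integerC F)]
  [CharP (ResidueField (integerC F)) p]
  [Fact (¬ IsUnit (p : maxUnramifiedCompletion F))] [CharP (ResidueField (maxUnramifiedCompletion F)) p]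

/-- ★ **`(A_max)^{Γ_F} = ι W(k_F)`** (any `F`): an element of `A_max = B_max⁺(F)` is `Γ_F`-invariant iff it is
`ι(W(ι₀) w)` for a Witt vector `w` over the residue field `k_F` of `F` (`ι₀ : k_F ↪ k̄`, `ι : W(k̄) → 𝔸_inf → A_max`).
Λ2 `forall_galBmaxPlus_iff` + `W(k̄)^{Γ_F} = W(k_F)`. [cite: Colmez1998Annals, §III.2]
[cite: FontaineAsterisque223III, Exp. III §4.1] -/
theorem forall_galBmaxPlus_iff_exists_witt (hp : valuation F p < 1) (x : BmaxPlus F p) :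
    (∀ σ : absoluteGaloisGroup F, galBmaxPlus σ x = x) ↔
      ∃ w : WittVector p 𝓀[F], x = ainfToBmaxPlus F p (wittToAinf F p (WittVector.map (D2Cris.resBarField F) w)) := by
  rw [forall_galBmaxPlus_iff hp x]
  exact D2Cris.exists_invariant_witt_iff _

/-- **`(A_max[1/p])^{Γ_F} = W(k_F)[1/p] = K₀`** (any `F`): Λ3 `forall_galBmax_iff_of_isPIntegral` with the Witt
vector over `k_F`. [cite: Colmez1998Annals, §III.2] [cite: FontaineAsterisque223III, Exp. III §4.1] -/
theorem forall_galBmax_iff_exists_witt_of_isPIntegral (hp : valuation F p < 1) {y : D2Cris.Bmax F p}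
    (hint : ∃ (n : ℕ) (x : BmaxPlus F p), y * (p : D2Cris.Bmax F p) ^ n = algebraMap (BmaxPlus F p) (D2Cris.Bmax F p) x) :
    (∀ σ : absoluteGaloisGroup F, D2Cris.galBmax σ y = y) ↔
      ∃ (n : ℕ) (w : WittVector p 𝓀[F]),
        y * (p : D2Cris.Bmax F p) ^ n =
          algebraMap (BmaxPlus F p) (D2Cris.Bmax F p)
            (ainfToBmaxPlus F p (wittToAinf F p (WittVector.map (D2Cris.resBarField F) w))) := by
  rw [forall_galBmax_iff_of_isPIntegral hp hint]
  constructor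
  · rintro ⟨n, z, hz, h⟩
    obtain ⟨w, rfl⟩ := (D2Cris.forall_map_residueGal_eq_iff z).1 hz
    exact ⟨n, w, h⟩
  · rintro ⟨n, w, h⟩
    exact ⟨n, _, (D2Cris.forall_map_residueGal_eq_iff _).2 ⟨w, rfl⟩, h⟩

/-- ★ **`B_max(F)^{Γ_F} = W(k_F)[1/p] = K₀` for absolutely unramified `F`, unconditionally**: if `p` is a
uniformiser of `F`, an element `y` of the constructed `B_max(F) = A_max[1/t]` is `Γ_F`-invariant iff
`y · pⁿ = ι(W(ι₀) w)` for some `n` and some Witt vector `w` over `k_F`.  Λ6 `forall_galBmax_iff_of_unramified` +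
`W(k̄)^{Γ_F} = W(k_F)`. [cite: Colmez1998Annals, §III.2–III.3] [cite: FontaineAsterisque223III, Exp. III §4.1]
[cite: SerreLocalFields1979, Ch. II §5] -/
theorem forall_galBmax_iff_exists_witt_of_unramified (hp : valuation F p < 1)
    (hF : Function.Surjective (fontaineTheta (integerC F) p)) (hur : Irreducible (p : 𝒪[F])) (y : D2Cris.Bmax F p) :
    (∀ σ : absoluteGaloisGroup F, D2Cris.galBmax σ y = y) ↔
      ∃ (n : ℕ) (w : WittVector p 𝓀[F]),
        y * (p : D2Cris.Bmax F p) ^ n =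
          algebraMap (BmaxPlus F p) (D2Cris.Bmax F p)
            (ainfToBmaxPlus F p (wittToAinf F p (WittVector.map (D2Cris.resBarField F) w))) := by
  rw [forall_galBmax_iff_of_unramified hp hF hur y]
  constructor
  · rintro ⟨n, z, hz, h⟩
    obtain ⟨w, rfl⟩ := (D2Cris.forall_map_residueGal_eq_iff z).1 hz
    exact ⟨n, w, h⟩
  · rintro ⟨n, w, h⟩
    exact ⟨n, _, (D2Cris.forall_map_residueGal_eq_iff _).2 ⟨w, rfl⟩, h⟩

/-- `K₀ ⊆ B_max(F)^{Γ_F}` (any `F`): `p⁻ⁿ ι(W(ι₀) w)` is `Γ_F`-invariant. [cite: FontaineAsterisque223III, Exp. II §1.5] -/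
theorem forall_galBmax_of_mul_pow_eq_witt (hp : valuation F p < 1) {y : D2Cris.Bmax F p} {n : ℕ} {w : WittVector p 𝓀[F]}
    (h : y * (p : D2Cris.Bmax F p) ^ n =
      algebraMap (BmaxPlus F p) (D2Cris.Bmax F p)
        (ainfToBmaxPlus F p (wittToAinf F p (WittVector.map (D2Cris.resBarField F) w))))
    (σ : absoluteGaloisGroup F) : D2Cris.galBmax σ y = y :=
  (forall_galBmax_iff_exists_witt_of_isPIntegral hp ⟨n, _, h⟩).2 ⟨n, w, h⟩ σ

end SpecC

end Summit.Langlands.Langlands.Theorems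

end
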